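import Literature.Computability.AlgebraicComplexity.TableauEvalKeyWalk
import Literature.Computability.AlgebraicComplexity.TableauEvalLabelMajorImpl
import HarnessLib

/-!
# The polarisation trie holds the symmetric-tensor entries (proofs for `TableauEvalKeyWalk.lean`, part 1)

Lean checker of the GCT multiplicity-obstruction engine (cells `pub-gct` / `pub-gct-max`; honest framing of those
cells: multiplicity-obstruction search for permanent versus determinant at small `(n, m)`; det-side certificates are
LOWER bounds `r ≤ mult`, i.e. negative census; no claim about VP ≠ VNP or P ≠ NP is made here or there).

`TableauEvalKeyWalk.lean` replaces the word trie `buildPTrie` (one `symEntry` per word of `[0,V)^m`) by the trie of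
iterated polar derivatives `trieD`. This file proves that the two agree where the label-major programme reads them:

* §1 `lperm_expand` — Laplace expansion of the list permanent `lperm` along the first column (via
  `permsSign (0 :: l⁺) = insertions of 0`, `sum_insertions_zero`);
* §2 `symEntry_cons_polar` — `symEntry P (v :: w) = symEntry (∂_v P) w` for a point all of whose terms have
  `|w| + 1` forms, and **`find_trieD`**: `(trieD V k P).find w = symEntry P w` for words of length `k` with letters
  `< V` — the exact analogue of `find_buildPTrie`, so that the tree's chain `specL_eq_evalC` / `symEntry_eq_S` applies
  verbatim to the new trie (`TableauEvalKeyWalkProofs.lean`).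

Elementary [folklore] list bookkeeping around the polarisation identity; no statement about representations is made here.
-/

namespace Literature.Computability.AlgebraicComplexity

namespace TableauEval

/-! ## §1 Laplace expansion of the list permanent along the first column -/

section Perm

variable {R : Type*} [CommRing R]

omit [CommRing R] in
/-- `insertions` commutes with `map`. [folklore] -/
private theorem insertions_map {α β : Type*} (f : α → β) (a : α) : ∀ l : List α,
    insertions (f a) (l.map f) = (insertions a l).map (fun q => (q.1, q.2.map f))
  | [] => rfl
  | b :: l => by
    simp [insertions, insertions_map f a l, List.map_map, Function.comp_def]

omit [CommRing R] in
/-- `permsSign` commutes with `map`. [folklore] -/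
private theorem permsSign_map {α β : Type*} (f : α → β) : ∀ l : List α,
    permsSign (l.map f) = (permsSign l).map (fun q => (q.1, q.2.map f))
  | [] => rfl
  | a :: l => by
    rw [List.map_cons, permsSign, permsSign, permsSign_map f l, List.flatMap_map, List.map_flatMap]
    refine List.flatMap_congr fun q _ => ?_
    simp only [insertions_map f a q.2, List.map_map, Function.comp_def]


/-- Every signed permutation of `l` has the length of `l`. [folklore] -/
private theorem snd_length_of_mem_permsSign {α : Type*} : ∀ (l : List α) (q : Bool × List α),
    q ∈ permsSign l → q.2.length = l.length
  | [], q, h => by simp [permsSign] at h; simp [h]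
  | a :: l, q, h => by
    rw [permsSign, List.mem_flatMap] at h
    obtain ⟨q', hq', h⟩ := h
    rw [List.mem_map] at h
    obtain ⟨r, hr, rfl⟩ := h
    have hlen : ∀ (l' : List α) (r : Bool × List α), r ∈ insertions a l' → r.2.length = l'.length + 1 := by
      intro l'
      induction l' with
      | nil => intro r hr; simp [insertions] at hr; simp [hr]
      | cons b l' ih =>
        intro r hr
        simp only [insertions, List.mem_cons, List.mem_map] at hr
        rcases hr with rfl | ⟨r', hr', rfl⟩
        · simp
        · simp [ih r' hr']
    simp [hlen _ r hr, snd_length_of_mem_permsSign l q' hq']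

/-- Reading a tail is reading one position further. [folklore] -/
private theorem getD_tail_succ (l : List R) (j : ℕ) : l.tail.getD j 0 = l.getD (j + 1) 0 := by
  cases l <;> simp

/-- Pairing tails with `p` is pairing the rows with `p + 1`. [folklore] -/
private theorem zipWith_getD_map_tail (M : List (List R)) (p : List ℕ) :
    List.zipWith (fun row j => row.getD j 0) (M.map List.tail) p =
      List.zipWith (fun row j => row.getD j 0) M (p.map Nat.succ) := by
  rw [List.zipWith_map_left, List.zipWith_map_right]
  congr 1
  funext row j
  exact getD_tail_succ row j

/-- **Inserting the column `0`**: summing the row products over the insertions of `0` into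
`p + 1` expands along the first column. [folklore] -/
private theorem sum_insertions_zero :
    ∀ (M : List (List R)) (p : List ℕ), M.length = p.length + 1 →
      ((insertions 0 (p.map Nat.succ)).map fun r =>
          (List.zipWith (fun row j => row.getD j 0) M r.2).prod).sum =
        ((List.range M.length).map fun s => (M.getD s []).getD 0 0 *
          (List.zipWith (fun row j => row.getD j 0) ((M.eraseIdx s).map List.tail) p).prod).sum
  | [], p, h => by simp at h
  | [row], [], _ => by simp [insertions]
  | [row], _ :: _, h => by simp at h
  | row :: row' :: M', [], h => by simp at h
  | row :: row' :: M', p₀ :: p', h => by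
    have h' : (row' :: M').length = p'.length + 1 := by simpa using h
    have IH := sum_insertions_zero (row' :: M') p' h'
    rw [List.map_cons, insertions, List.map_cons, List.sum_cons, List.map_map]
    -- the right-hand side: `s = 0` and `s + 1`
    rw [List.length_cons, List.range_succ_eq_map, List.map_cons, List.sum_cons, List.map_map]
    congr 1
    · -- `0` inserted in front
      simp only [List.zipWith_cons_cons, List.prod_cons, List.getD_cons_zero, List.eraseIdx_cons_zero,
        zipWith_getD_map_tail, List.map_cons, getD_tail_succ, Nat.succ_eq_add_one]
    · -- `0` inserted further down: factor `row[p₀+1]` out and use the induction hypothesis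
      have e1 : ((insertions 0 (List.map Nat.succ p')).map
          ((fun r => (List.zipWith (fun row j => row.getD j 0) (row :: row' :: M') r.2).prod) ∘
            fun q => (!q.1, p₀.succ :: q.2))) =
          (insertions 0 (List.map Nat.succ p')).map fun r =>
            row.getD (p₀ + 1) 0 * (List.zipWith (fun row j => row.getD j 0) (row' :: M') r.2).prod := by
        refine List.map_congr_left fun r _ => ?_
        simp
      rw [e1, List.sum_map_mul_left, IH, ← List.sum_map_mul_left]
      congr 1
      refine List.map_congr_left fun s _ => ?_
      simp only [Function.comp_apply, List.getD_cons_succ, List.eraseIdx_cons_succ, List.map_cons,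
        List.zipWith_cons_cons, List.prod_cons, getD_tail_succ, Nat.succ_eq_add_one]
      ring


/-- Swapping two list summations. [folklore] -/
private theorem sum_map_sum_swap {α β M : Type*} [AddCommMonoid M] (l₂ : List β) (f : α → β → M) :
    ∀ l₁ : List α, (l₁.map fun a => (l₂.map fun b => f a b).sum).sum =
      (l₂.map fun b => (l₁.map fun a => f a b).sum).sum
  | [] => by simp
  | a :: l₁ => by
    rw [List.map_cons, List.sum_cons, sum_map_sum_swap l₂ f l₁, ← List.sum_map_add]
    rfl

/-- **Laplace expansion of the list permanent along the first column**: for a list of `n + 1`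
rows, `lperm M = ∑_{s ≤ n} M[s][0] · lperm (rows ≠ s, shifted by one column)`. [folklore] -/
private theorem lperm_expand (M : List (List R)) (n : ℕ) (hM : M.length = n + 1) :
    lperm M = ((List.range (n + 1)).map fun s =>
      (M.getD s []).getD 0 0 * lperm ((M.eraseIdx s).map List.tail)).sum := by
  have hmin : ∀ s ∈ List.range (n + 1), ((M.eraseIdx s).map List.tail).length = n := by
    intro s hs
    rw [List.mem_range] at hs
    rw [List.length_map, List.length_eraseIdx_of_lt (by omega), hM]
    rfl
  unfold lperm
  rw [hM, show permsSign (List.range (n + 1)) = (permsSign (List.range n)).flatMap fun q =>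
      (insertions 0 (q.2.map Nat.succ)).map fun r => (xor q.1 r.1, r.2) by
    rw [List.range_succ_eq_map, permsSign, permsSign_map, List.flatMap_map], sum_map_flatMap]
  -- expand every permutation of the remaining columns along the inserted column `0`
  have e1 : ((permsSign (List.range n)).map fun q =>
      (((insertions 0 (q.2.map Nat.succ)).map fun r => (xor q.1 r.1, r.2)).map
        fun q => (List.zipWith (fun row j => row.getD j 0) M q.2).prod).sum) =
      (permsSign (List.range n)).map fun q => ((List.range (n + 1)).map fun s =>
        (M.getD s []).getD 0 0 *
          (List.zipWith (fun row j => row.getD j 0) ((M.eraseIdx s).map List.tail) q.2).prod).sum := by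
    refine List.map_congr_left fun q hq => ?_
    have hlen : q.2.length = n := by rw [snd_length_of_mem_permsSign _ q hq, List.length_range]
    rw [List.map_map, ← hM]
    exact sum_insertions_zero M q.2 (by rw [hM, hlen])
  rw [e1, sum_map_sum_swap]
  refine congrArg List.sum (List.map_congr_left fun s hs => ?_)
  rw [← List.sum_map_mul_left, hmin s hs]

end Perm

/-! ## §2 Polarisation: the trie holds the symmetric-tensor entries -/

section PolarProofs

variable {R : Type*} [CommRing R]

/-- A point none of whose terms has a form left evaluates, at the empty word, to the sum of its
coefficients. [folklore] -/
private theorem symEntry_nil_of (P : Point R) (h : ∀ t ∈ P.terms, t.2.length = 0) :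
    symEntry P [] = Point.const P := by
  unfold symEntry Point.const
  refine congrArg List.sum (List.map_congr_left fun t ht => ?_)
  have h0 : t.2 = [] := List.length_eq_zero_iff.mp (h t ht)
  simp [h0, lperm, permsSign]

/-- Summing `a · L m` over the pruned list of `(a, m)` is summing over all `s`. [folklore] -/
private theorem sum_filterMap_prune [DecidableEq R] {β : Type*} (c : ℕ → R) (m : ℕ → β) (L : β → R) :
    ∀ l : List ℕ, (((l.filterMap fun s => if c s = 0 then none else some (c s, m s))).map
        fun t : R × β => t.1 * L t.2).sum = (l.map fun s => c s * L (m s)).sum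
  | [] => rfl
  | s :: l => by
    rw [List.filterMap_cons, List.map_cons, List.sum_cons, ← sum_filterMap_prune c m L l]
    split_ifs with h
    · rw [h, zero_mul, zero_add]
    · rw [List.map_cons, List.sum_cons]

/-- **Polarisation step**: for a point all of whose terms have `k + 1` forms,
`symEntry P (v :: w) = symEntry (∂_v P) w` — Laplace expansion of every permanent along the column
of the letter `v`. [folklore] -/
private theorem symEntry_cons_polar [DecidableEq R] (P : Point R) (k : ℕ)
    (h : ∀ t ∈ P.terms, t.2.length = k + 1) (v : ℕ) (w : List ℕ) :
    symEntry P (v :: w) = symEntry (Point.polar P v) w := by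
  unfold symEntry Point.polar
  rw [sum_map_flatMap]
  refine congrArg List.sum (List.map_congr_left fun t ht => ?_)
  have hk := h t ht
  have hlen : (t.2.map fun ℓ => (v :: w).map fun i => ℓ.getD i 0).length = k + 1 := by
    rw [List.length_map, hk]
  have hp := sum_filterMap_prune (fun s => t.1 * (t.2.getD s []).getD v 0) (fun s => t.2.eraseIdx s)
    (fun m => lperm (m.map fun ℓ => w.map fun i => ℓ.getD i 0)) (List.range t.2.length)
  rw [hp, lperm_expand _ k hlen, ← List.sum_map_mul_left, hk]
  refine congrArg List.sum (List.map_congr_left fun s hs => ?_)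
  have hs' : s < t.2.length := by rw [hk]; exact List.mem_range.mp hs
  have e1 : ((t.2.map fun ℓ => (v :: w).map fun i => ℓ.getD i 0).getD s []).getD 0 0 =
      (t.2.getD s []).getD v 0 := by
    rw [List.getD_eq_getElem (l := t.2.map fun ℓ => (v :: w).map fun i => ℓ.getD i 0) (d := [])
      (by rw [List.length_map]; exact hs'), List.getElem_map, List.getD_eq_getElem (l := t.2) (d := []) hs']
    simp
  have e2 : ((t.2.map fun ℓ => (v :: w).map fun i => ℓ.getD i 0).eraseIdx s).map List.tail =
      (t.2.eraseIdx s).map fun ℓ => w.map fun i => ℓ.getD i 0 := by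
    rw [List.eraseIdx_map, List.map_map]
    rfl
  rw [e1, e2]
  ring

/-- The terms of `∂_v P` have one form fewer. [folklore] -/
private theorem length_of_mem_polar [DecidableEq R] (P : Point R) (k : ℕ)
    (h : ∀ t ∈ P.terms, t.2.length = k + 1) (v : ℕ) :
    ∀ t ∈ (Point.polar P v).terms, t.2.length = k := by
  intro t' ht'
  unfold Point.polar at ht'
  simp only [List.mem_flatMap, List.mem_filterMap, List.mem_range] at ht'
  obtain ⟨t, ht, s, hs, hts⟩ := ht'
  split_ifs at hts with h0
  simp only [Option.some.injEq] at hts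
  rw [← hts, List.length_eraseIdx_of_lt hs, h t ht]
  rfl

/-- The empty word looks up the pruned leaf. [folklore] -/
private theorem find_mkLeaf [DecidableEq R] (a : R) : (PTrie.mkLeaf a).find [] = a := by
  unfold PTrie.mkLeaf
  split_ifs with h
  · rw [PTrie.find_empty, h]
  · rfl

/-- **The polarisation trie holds the symmetric-tensor entries**: for a point all of whose terms
have `k` forms and a word `w` of length `k` with letters `< V`, `find w (trieD V k P) = symEntry P w`.
[cite: DorflerIkenmeyerPanova2020, §5] -/
theorem find_trieD [DecidableEq R] (V : ℕ) : ∀ (k : ℕ) (P : Point R) (w : List ℕ),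
    (∀ t ∈ P.terms, t.2.length = k) → w.length = k → (∀ v ∈ w, v < V) →
    (trieD V k P).find w = symEntry P w
  | 0, P, w, hP, hw, _ => by
    rw [List.length_eq_zero_iff] at hw
    subst hw
    rw [trieD, find_mkLeaf, symEntry_nil_of P hP]
  | k + 1, P, [], hP, hw, _ => by simp at hw
  | k + 1, P, v :: w, hP, hw, hv => by
    have hvV : v < V := hv v List.mem_cons_self
    have hw' : w.length = k := by simpa using hw
    have IH := find_trieD V k (Point.polar P v) w (length_of_mem_polar P k hP v) hw'
      (fun x hx => hv x (List.mem_cons_of_mem _ hx))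
    rw [symEntry_cons_polar P k hP v w, ← IH, trieD]
    split_ifs with he
    · -- no terms: both sides vanish
      have h0 : (Point.polar P v).terms = [] := by
        unfold Point.polar; rw [List.isEmpty_iff.mp he]; rfl
      rw [PTrie.find_empty, IH]
      unfold symEntry; rw [h0]; rfl
    · simp only [PTrie.mkNode]
      split_ifs with hall
      · -- every child is empty, in particular the `v`-th
        rw [PTrie.find_empty]
        have hmem : trieD V k (Point.polar P v) ∈ (List.range V).map fun i => trieD V k (Point.polar P i) :=
          List.mem_map.mpr ⟨v, List.mem_range.mpr hvV, rfl⟩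
        rw [(PTrie.isEmpty_iff _).mp ((List.all_eq_true.mp hall) _ hmem), PTrie.find_empty]
      · rw [PTrie.find_cons, PTrie.child, List.getD_eq_getElem (d := PTrie.empty) (hn := by simpa using hvV)]
        simp only [List.getElem_map, List.getElem_range]

end PolarProofs

end TableauEval

end Literature.Computability.AlgebraicComplexity
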